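import Summits.ResolutionOfSingularities.ResolutionOfSingularities.Theorems.WeightedInvariantLocalWeightedDropMonomialPhase
import Summits.ResolutionOfSingularities.ResolutionOfSingularities.Theorems.WeightedInvariantLocalWeightedDropTameResidualOfTupleDrop
import Literature.AlgebraicGeometry.Resolution.EmbeddedResolutionExcellentSurfacesSequence

/-!
# `LocalWeightedDrop`, line `tame-four-tuple-drop`: stub (G3) `stub_tupleDropSpace` BY NAME and the line's composition `…_of_pieces`

[OURS · L1 W4.3 · chain w43, engine crux `LocalWeightedDrop` stmt-ResolutionOfSingularities-8899; strategist res-L1-w43-strat-1's line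
`tame-four-tuple-drop` (`L/res-L1-w43-strat-1/tame_four_tuple_drop_v1.lean` sha16 9c94f6e133b67480); (G3) holder res-type-088 per CHAIN
v4.5.1.]  NOT a statement of any manuscript; the coefficient-tuple game (`TupleGame.Drop`) is the programme's own.

* `TameFourTupleDrop.stub_tupleDropSpace` — the registered stub (G3), signature VERBATIM from the line file: a radical non-normal-crossing
  count with free smooth centres (`SpaceGermNonNCCountRad k`) and the monomial phase (`SpaceMonomialPhase k`) give `TupleGame.Drop k 3 e`
  for every `e`.  Proof = the predicate- and dimension-generic assembly `tupleDropThree_of_count_of_monomialPhase` (p501911) at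
  `P := SpaceIsNC`, fed with the count's three clauses and the monomial-phase hypothesis AS GIVEN (the hypothesis is consumed, not
  discarded — the by-name composition of the line is (A3) → (B3) → (G3)).  With (A3) `stub_spaceNonNCCountRad_of_CJS` (p504769) and
  (B3) `stub_spaceMonomialPhase` (p506875) all three stubs of the line are now tree theorems by name.
* `TameFourTupleDrop.tameWideApexFourStartsWon_of_pieces` — the line file's kernel-checked COMPOSITION, VERBATIM: pieces of the shapes
  (A3), (B3), (G3) and ⟨F-32bR⟩ `CossartJannsenSaito2020EmbeddedSequenceB` give the N = 4 TAME residual `stub_tameWideApexFourStartsWon`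
  of the registered engine skeleton v29 (statement VERBATIM), through `tameWideApexFourStartsWon_of_tupleDrop` (p500325).
-/

set_option linter.dupNamespace false -- mandated namespace of this single-conjunct summit

namespace Summit.ResolutionOfSingularities.ResolutionOfSingularities.Theorems.TameFourTupleDrop

open Literature.AlgebraicGeometry.Resolution

/-- **(G3) THE ASSEMBLY OF THE THREE-VARIABLE TUPLE GAME** — stub `stub_tupleDropSpace` of the line `tame-four-tuple-drop`, signature
VERBATIM: over any field, a radical non-normal-crossing count with free smooth centres on `k⟦x₀,x₁,x₂⟧` together with the monomial phase of
the tuple game in three variables wins the coefficient-tuple game `TupleGame.Drop k 3 e` for every `e`.  (Instance `P := SpaceIsNC` of the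
generic assembly `tupleDropThree_of_count_of_monomialPhase`, p501911.) [OURS · L1 W4.3] -/
theorem stub_tupleDropSpace : ∀ (k : Type) [Field k], SpaceGermNonNCCountRad k → SpaceMonomialPhase k →
    ∀ e : ℕ, TupleGame.Drop k 3 e := by
  intro k _ hrad hmono
  obtain ⟨ν, h₁, h₂, h₃⟩ := hrad
  exact tupleDropThree_of_count_of_monomialPhase SpaceIsNC ν h₁ h₂ h₃ hmono

/-- **COMPOSITION OF THE LINE `tame-four-tuple-drop`** (the line file's kernel-checked reduction, VERBATIM): pieces of the shapes
(A3) «⟨F-32bR⟩ ⇒ the count over every field», (B3) «the monomial phase over every field», (G3) «count + monomial phase ⇒ the tuple game»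
and the hypothesis ⟨F-32bR⟩ `CossartJannsenSaito2020EmbeddedSequenceB` give the N = 4 TAME residual piece `stub_tameWideApexFourStartsWon`
of the engine skeleton (v29), statement VERBATIM. [OURS · L1 W4.3] -/
theorem tameWideApexFourStartsWon_of_pieces
    (hA : CossartJannsenSaito2020EmbeddedSequenceB.{0} → ∀ (k : Type) [Field k], SpaceGermNonNCCountRad k)
    (hB : ∀ (k : Type) [Field k], SpaceMonomialPhase k)
    (hG : ∀ (k : Type) [Field k], SpaceGermNonNCCountRad k → SpaceMonomialPhase k → ∀ e : ℕ, TupleGame.Drop k 3 e)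
    (hCJS : CossartJannsenSaito2020EmbeddedSequenceB.{0}) :
    ∀ (p : ℕ), p.Prime → ∀ (k : Type) [Field k] [CharP k p] [IsAlgClosed k],
    (∀ m : ℕ, m < 4 → ∀ g : MvPowerSeries (Fin m) k,
      CobordantGame.IsSingular k g → CobordantGame.Won k m g) →
    ∀ (f : MvPowerSeries (Fin 4) k), CobordantGame.IsSingular k f →
    (∀ g : MvPowerSeries (Fin 4) k, CobordantGame.IsSingular k g → g.order < f.order →
      CobordantGame.Won k 4 g) →
    ∀ (d : ℕ), f.order = d → ¬ p ∣ d →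
    (∃ ℓ : Fin 4 → k, ∀ i j : Fin 4,
      MvPowerSeries.coeff (Finsupp.single i 1 + Finsupp.single j 1) f =
        MvPowerSeries.coeff (Finsupp.single i 1 + Finsupp.single j 1)
          ((∑ l, MvPowerSeries.C (ℓ l) * MvPowerSeries.X l) ^ 2)) →
    (2 < d → ∃ c₁ c₂ : Fin 4 → k, (∀ α β : k, α • c₁ + β • c₂ = 0 → α = 0 ∧ β = 0) ∧
      (∀ v : Fin 4 → k, CobordantChart.initEval (fun _ : Fin 4 => 1) (v + c₁) d f =
        CobordantChart.initEval (fun _ : Fin 4 => 1) v d f) ∧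
      (∀ v : Fin 4 → k, CobordantChart.initEval (fun _ : Fin 4 => 1) (v + c₂) d f =
        CobordantChart.initEval (fun _ : Fin 4 => 1) v d f)) →
    CobordantGame.Won k 4 f :=
  tameWideApexFourStartsWon_of_tupleDrop fun _ _ k _ _ _ e => hG k (hA hCJS k) (hB k) e

end Summit.ResolutionOfSingularities.ResolutionOfSingularities.Theorems.TameFourTupleDrop
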